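import Summits.HubbardSuperconductivity.HubbardSuperconductivity.Theses.BcsKacWindow
import Summits.HubbardSuperconductivity.HubbardSuperconductivity.Theorems.BcsKacWindowInfraredCompletionRate

/-!
# Strategist sketch — crux `InfraredCompletion` (stmt-HubbardSuperconductivity-1321, route BcsKacWindow)

Companion of `Cruxes/InfraredCompletion/STRATEGY-CENSUS.md` (planner-cstrat-stmt-HubbardSuperconductivity-1321-s1-0,
2026-08-17). Kernel-checked artefacts of the census; NO definition here is proposed to the tree and nothing
here proves the crux, a stub, or the summit.

* §N (negation) `coherenceWindowLRO_of_not_infraredCompletion` — refuting the crux PROVES the route's rank-2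
  crux `CoherenceWindowLRO`: a counterexample to the transfer must first exhibit data on which the coherence
  window holds. `infraredCompletion_or_coherenceWindowLRO` is the same fact as a disjunction.
* §R (the one switch with teeth — a lockstep RESTATEMENT, which only the tenure planner may apply) the
  polynomially-RATED pair `CoherenceWindowLROPolyRate` (window with an exported rate `S(U) = U⁻¹ ^ q`,
  STRONGER than `CoherenceWindowLRO`) and `InfraredCompletionPolyRate` (transfer at polynomial rates, WEAKER
  than `InfraredCompletion` by `ratedTransfer_of_infraredCompletion`, p157050), with the re-glue
  `target_of_polyRate : CoherenceWindowLROPolyRate → InfraredCompletionPolyRate → Target` and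
  `closes_polyRate … : HubbardSuperconductivity` proved (same two lines as the route's `closes`).
-/

noncomputable section

set_option linter.dupNamespace false

open scoped Classical Matrix BigOperators

namespace Summit.HubbardSuperconductivity.HubbardSuperconductivity.Cruxes.InfraredCompletion.Strategist

open Literature.MathematicalPhysics.QuantumLattice Literature.Probability.LatticeModels
open Summit.HubbardSuperconductivity.HubbardSuperconductivity.Theses.BcsKacWindow
open Summit.HubbardSuperconductivity.HubbardSuperconductivity.Theorems.InfraredCompletion
  (ratedTransfer_of_infraredCompletion)

/-! ### §N  Negation obstruction: `¬ InfraredCompletion → CoherenceWindowLRO` -/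

/-- **Refuting the transfer proves the window.** If `InfraredCompletion` fails, some datum
`(a,b,κ₁,κ₂,c₀,s₀,Δ)` satisfies the guards, the flat pin and the coherence-window bound W (and violates the
bulk conclusion); that datum is a witness of `CoherenceWindowLRO`. Pure logic. [folklore] -/
theorem coherenceWindowLRO_of_not_infraredCompletion (h : ¬ InfraredCompletion) : CoherenceWindowLRO := by
  by_contra hW
  apply h
  intro a b κ₁ κ₂ c₀ s₀ Δ ha hab hb hκ₁ hκ hc₀ hs₀ hpin hwin
  exact (hW ⟨a, b, κ₁, κ₂, c₀, s₀, Δ, ha, hab, hb, hκ₁, hκ, hc₀, hs₀, hpin, hwin⟩).elim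

/-- The two thesis cruxes of route `BcsKacWindow` cannot both be false. [folklore] -/
theorem infraredCompletion_or_coherenceWindowLRO : InfraredCompletion ∨ CoherenceWindowLRO := by
  by_cases h : InfraredCompletion
  · exact Or.inl h
  · exact Or.inr (coherenceWindowLRO_of_not_infraredCompletion h)

/-! ### §R  The rated restatement packet (polynomial window-top rate `S(U) = (1/U)^q`) -/

/-- Rated window hypothesis: the coherence-window bound up to window top `U⁻¹ ^ q` below some `Us`. -/
def WindowAtPolyRate (q : ℕ) (a b c₀ s₀ : ℝ) (Δ : ℝ → ℝ) : Prop :=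
  ∃ Us : ℝ, 0 < Us ∧ ∀ δ ∈ Set.Icc a b, ∀ U ∈ Set.Ioo (0:ℝ) Us,
    ∀ (L : ℕ) [NeZero L], Even L → s₀ ≤ Δ U * L → Δ U * L ≤ U⁻¹ ^ q →
      ∀ ψ : Fock (Orb (FermionTorus 2 L)), star ψ ⬝ᵥ ψ = 1 →
        IsGroundStateInSector (hubbardTorus 2 L 1 U) (2 * ⌊(1 - δ) * (L : ℝ) ^ 2 / 2⌋₊) 0 ψ →
          c₀ * Δ U ^ 2 ≤ (expect ((pairField dWaveFormFactor L)ᴴ * pairField dWaveFormFactor L)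
            ψ).re / (L : ℝ) ^ 4

/-- Bulk conclusion (verbatim the consequent of `InfraredCompletion`). -/
def BulkOrder (a b : ℝ) (Δ : ℝ → ℝ) : Prop :=
  ∃ c₁ s₁ U₁ : ℝ, 0 < c₁ ∧ 0 < U₁ ∧ ∀ δ ∈ Set.Icc a b, ∀ U ∈ Set.Ioo (0:ℝ) U₁,
    ∀ (L : ℕ) [NeZero L], Even L → s₁ ≤ Δ U * L →
      ∀ ψ : Fock (Orb (FermionTorus 2 L)), star ψ ⬝ᵥ ψ = 1 →
        IsGroundStateInSector (hubbardTorus 2 L 1 U) (2 * ⌊(1 - δ) * (L : ℝ) ^ 2 / 2⌋₊) 0 ψ →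
          c₁ * Δ U ^ 2 ≤ (expect ((pairField dWaveFormFactor L)ᴴ * pairField dWaveFormFactor L)
            ψ).re / (L : ℝ) ^ 4

/-- **1319′ (candidate restatement)**: the coherence window WITH an exported polynomial rate. -/
def CoherenceWindowLROPolyRate : Prop :=
  ∃ (q : ℕ) (a b κ₁ κ₂ c₀ s₀ : ℝ) (Δ : ℝ → ℝ), 1 ≤ q ∧ 0 < a ∧ a < b ∧ b < 1 / 2 ∧ 0 < κ₁ ∧ κ₁ ≤ κ₂ ∧
    0 < c₀ ∧ 0 < s₀ ∧ (∀ U : ℝ, 0 < U → Real.exp (-(κ₂ / U ^ 2)) ≤ Δ U ∧ Δ U ≤ Real.exp (-(κ₁ / U ^ 2))) ∧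
    WindowAtPolyRate q a b c₀ s₀ Δ

/-- **1321′ (candidate restatement)**: the window ⇒ bulk transfer AT POLYNOMIAL RATES only. -/
def InfraredCompletionPolyRate : Prop :=
  ∀ (q : ℕ) (a b κ₁ κ₂ c₀ s₀ : ℝ) (Δ : ℝ → ℝ), 1 ≤ q → 0 < a → a < b → b < 1 / 2 → 0 < κ₁ → κ₁ ≤ κ₂ →
    0 < c₀ → 0 < s₀ → (∀ U : ℝ, 0 < U → Real.exp (-(κ₂ / U ^ 2)) ≤ Δ U ∧ Δ U ≤ Real.exp (-(κ₁ / U ^ 2))) →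
    WindowAtPolyRate q a b c₀ s₀ Δ → BulkOrder a b Δ

/-- `U ↦ U⁻¹ ^ q` diverges at `0⁺` for `q ≥ 1`. [folklore] -/
theorem inv_pow_diverges {q : ℕ} (hq : 1 ≤ q) :
    ∀ M : ℝ, ∃ U₂ : ℝ, 0 < U₂ ∧ ∀ U ∈ Set.Ioo (0:ℝ) U₂, M ≤ U⁻¹ ^ q := by
  intro M
  refine ⟨min 1 (1 / max M 1), by positivity, fun U hU => ?_⟩
  have hU0 : 0 < U := hU.1
  have hU1 : U < 1 := lt_of_lt_of_le hU.2 (min_le_left _ _)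
  have hUM : U < 1 / max M 1 := lt_of_lt_of_le hU.2 (min_le_right _ _)
  have hinv1 : 1 ≤ U⁻¹ := by rw [one_le_inv₀ hU0]; exact hU1.le
  have hMpos : 0 < max M 1 := lt_of_lt_of_le one_pos (le_max_right _ _)
  have hMinv : max M 1 ≤ U⁻¹ := by
    rw [le_inv_comm₀ hMpos hU0]
    simpa [one_div] using hUM.le
  calc M ≤ max M 1 := le_max_left _ _
    _ ≤ U⁻¹ := hMinv
    _ ≤ U⁻¹ ^ q := le_self_pow₀ hinv1 (by omega)

/-- **1321 ⇒ 1321′**: the typed crux implies the polynomially-rated transfer (an instance of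
`ratedTransfer_of_infraredCompletion`, p157050, at `S U = U⁻¹ ^ q`). [folklore] -/
theorem infraredCompletionPolyRate_of_infraredCompletion (hI : InfraredCompletion) :
    InfraredCompletionPolyRate := by
  intro q a b κ₁ κ₂ c₀ s₀ Δ hq ha hab hb hκ₁ hκ hc₀ hs₀ hpin hW
  exact ratedTransfer_of_infraredCompletion hI (fun U => U⁻¹ ^ q) (inv_pow_diverges hq)
    a b κ₁ κ₂ c₀ s₀ Δ ha hab hb hκ₁ hκ hc₀ hs₀ hpin hW

/-- **1319′ ⇒ 1319**: a polynomially-rated window is a rate-free window (`U₁(s) := min Us (min 1 s⁻¹)`: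
for `U < U₁(s)` one has `s ≤ U⁻¹ ≤ U⁻¹ ^ q`). [folklore] -/
theorem coherenceWindowLRO_of_polyRate (h : CoherenceWindowLROPolyRate) : CoherenceWindowLRO := by
  obtain ⟨q, a, b, κ₁, κ₂, c₀, s₀, Δ, hq, ha, hab, hb, hκ₁, hκ, hc₀, hs₀, hpin, Us, hUs, hW⟩ := h
  refine ⟨a, b, κ₁, κ₂, c₀, s₀, Δ, ha, hab, hb, hκ₁, hκ, hc₀, hs₀, hpin, fun s hs => ?_⟩
  have hspos : 0 < s := lt_of_lt_of_le hs₀ hs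
  refine ⟨min Us (min 1 s⁻¹), by positivity, fun δ hδ U hU L _ hE hlo hhi ψ hψ hgs => ?_⟩
  have hU0 : 0 < U := hU.1
  have hUUs : U < Us := lt_of_lt_of_le hU.2 (min_le_left _ _)
  have hU1 : U < 1 := lt_of_lt_of_le hU.2 ((min_le_right _ _).trans (min_le_left _ _))
  have hUs' : U < s⁻¹ := lt_of_lt_of_le hU.2 ((min_le_right _ _).trans (min_le_right _ _))
  have hinv1 : 1 ≤ U⁻¹ := by rw [one_le_inv₀ hU0]; exact hU1.le
  have hsU : s ≤ U⁻¹ := by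
    rw [le_inv_comm₀ hspos hU0]
    exact hUs'.le
  have htop : Δ U * L ≤ U⁻¹ ^ q :=
    hhi.trans (hsU.trans (le_self_pow₀ hinv1 (by omega)))
  exact hW δ hδ U ⟨hU0, hUUs⟩ L hE hlo htop ψ hψ hgs

/-- **Re-glue under the restatement**: `1319′ → 1321′ → Target` (bookkeeping identical to the landed
`targetOfWindow_proof`: `c := c₁Δ(U)²`, `L₀ := s₁/Δ(U)`). [folklore] -/
theorem target_of_polyRate (hW : CoherenceWindowLROPolyRate) (hI : InfraredCompletionPolyRate) : Target := by
  obtain ⟨q, a, b, κ₁, κ₂, c₀, s₀, Δ, hq, ha, hab, hb, hκ₁, hκ, hc₀, hs₀, hpin, hwin⟩ := hW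
  obtain ⟨c₁, s₁, U₁, hc₁, hU₁, hbulk⟩ := hI q a b κ₁ κ₂ c₀ s₀ Δ hq ha hab hb hκ₁ hκ hc₀ hs₀ hpin hwin
  refine ⟨a, b, U₁, ha, hab, hb, hU₁, fun δ hδ U hU => ?_⟩
  have hΔ : 0 < Δ U := lt_of_lt_of_le (Real.exp_pos _) (hpin U hU.1).1
  refine ⟨c₁ * Δ U ^ 2, s₁ / Δ U, by positivity, fun L _ hE hL₀ ψ hψ hgs => ?_⟩
  have hsL : s₁ ≤ Δ U * L := by
    rw [div_le_iff₀ hΔ] at hL₀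
    linarith [mul_comm (L : ℝ) (Δ U)]
  exact hbulk δ hδ U hU L hE hsL ψ hψ hgs

/-- **Deciding theorem under the restatement** (preview; same shape as the route's `closes`). -/
theorem closes_polyRate (hW : CoherenceWindowLROPolyRate) (hI : InfraredCompletionPolyRate)
    (hP : PairDensityBounded) (hS : StatementOfTarget) : _root_.HubbardSuperconductivity :=
  hS (target_of_polyRate hW hI) hP

end Summit.HubbardSuperconductivity.HubbardSuperconductivity.Cruxes.InfraredCompletion.Strategist

end
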